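import Literature.AlgebraicGeometry.Motives.HodgeStructurePseudoPolarized
import Mathlib.NumberTheory.NumberField.CanonicalEmbedding.Basic
import Mathlib.LinearAlgebra.TensorProduct.Pi
import Mathlib.RingTheory.TensorProduct.Free
import Mathlib.RingTheory.TensorProduct.Finite
import Mathlib.LinearAlgebra.FiniteDimensional.Lemmas
import Mathlib.LinearAlgebra.Eigenspace.Minpoly
import Mathlib.LinearAlgebra.Matrix.ToLin
import Mathlib.LinearAlgebra.Dual.Lemmas
import Mathlib.Analysis.SpecialFunctions.Pow.Real
import Mathlib.Analysis.Real.Cardinality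
import Mathlib.Algebra.Polynomial.Roots
import HarnessLib

/-!
# Proof of Bayer-Fluckiger–van Geemen–Schütt 2025, Thm. 7.1 (real multiplication on `T_E(⟨α⟩)`)

This file discharges the named fact
`Literature.AlgebraicGeometry.Motives.HodgeStructure.BFvGS2025_exists_pseudoPolarization_endAlg_eq`
of `Literature/AlgebraicGeometry/Motives/HodgeStructurePseudoPolarized.lean`
(`BFvGS2025_exists_pseudoPolarization_endAlg_eq_holds`, at the end): for `E` totally real,
`m > 2`, `W = ⟨α₁, …, α_m⟩` non-degenerate diagonal over `E`, `σ : E → ℝ` with `2` or `3` of the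
`σ(αᵢ)` positive and `T_E(W)` of signature `(3, dm - 3)`, there is a weight-`2` Hodge structure on
the `ℚ`-space `E^m`, pseudo-polarized by the bilinear form of `T_E(W)`, with `V^{2,0}` in the
`σ`-eigenspace and Hodge endomorphism algebra EXACTLY `E`.

Source, read at the locator (E. Bayer-Fluckiger, B. van Geemen, M. Schütt, *Non-projective K3
surfaces with real or Salem multiplication*, arXiv:2511.19970, §7, Thm. 7.1 and its proof, p. 14
of the materialised text `lit read arxiv:2511.19970`): "There is an isomorphism of `E`-vector
spaces `T(W) ≅ E^m`. The quadratic form on the complexification `W_{σ,ℂ} ≅ ℂ^m` defines a quadric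
`Q := {[ω] ∈ ℙ(W_{σ,ℂ}) : (ω, ω) = 0}` of dimension `m - 2 ≥ 1` and there is a non-empty open
subset, in the analytical topology, `Q⁺` such that `(ω, ω̄) > 0` for `[ω] ∈ Q⁺`. Any such `ω`
defines a pseudo-polarized Hodge structure of K3 type on `T_ℚ := T(W)` by `T^{2,0} := ℂ ω`,
`T^{0,2} := ℂ ω̄`, `T^{1,1} := (T^{2,0} ⊕ T^{0,2})^⊥`. By construction, `E ⊂ A_T`. If `E ≠ A_T`,
then `A_T` is a number field of degree `dk` for some `k ≥ 2`, and `ω` lies in an eigenspace of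
`A_T` in `T_ℂ`, which has dimension `m/k < m`. There are only countably many subspaces in
`End_ℚ(T_ℚ)`, and hence subalgebras `A_T ⊂ End_ℚ(T_ℚ)`, and thus there are only countably many
such (lower-dimensional) complexified eigenspaces contained in `W_{σ,ℂ}`. So for a very general
`ω ∈ Q⁺` we must have `E = A_T`."

## Proof (following the printed one; the tree's Hodge structures are in filtration form)

* **The Hodge structure of a period vector** (`periodF`, `ofPeriod`; §`Period`): for a rational
  bilinear form `B` on `V` and `ω ∈ V_ℂ = ℂ ⊗_ℚ V` with `B_ℂ(ω, ω) = 0`, `B_ℂ(ω, ω̄) ≠ 0`, the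
  filtration `F^{≤ 0} = V_ℂ ⊋ F^1 = ω^⊥ ⊋ F^2 = ℂ ω ⊋ F^{≥ 3} = 0` is `2`-opposed to its conjugate
  (`ℂ ω ⊕ ω̄^⊥ = V_ℂ = ω^⊥ ⊕ ℂ ω̄`), with pieces `V^{2,0} = ℂ ω`, `V^{0,2} = ℂ ω̄`,
  `V^{1,1} = ω^⊥ ∩ ω̄^⊥` — the printed `T^{2,0}, T^{0,2}, T^{1,1}`; it is of K3 type
  (`isOfK3Type_ofPeriod`) and pseudo-polarized by `B` when `B` is symmetric of signature
  `(3, dim V - 3)` and `B_ℂ(ω, ω̄) > 0` (`isPseudoPolarization_ofPeriod`, Def. 2.5). A Hodge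
  endomorphism has `ω` as an eigenvector (`exists_smul_eq_of_mem_endAlg_ofPeriod`: it preserves
  `F^2 = ℂ ω`), and conversely a `B`-self-adjoint map with eigenvector `ω` preserves `ω^⊥`, hence
  the filtration (`mem_endAlg_ofPeriod`) — this is "by construction, `E ⊂ A_T`" (the `E`-action is
  self-adjoint for a transfer, Lemma 3.1, `trForm_lsmul`).
* **Coordinates** (§`Coords`, namespace `RealMult`): `ℂ ⊗_ℚ E ≅ ℂ^{Hom(E,ℂ)}`, `z ⊗ e ↦ (z τ(e))_τ`
  (`embCoords`, from Mathlib's `canonicalEmbedding.latticeBasis` = linear independence of the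
  embeddings) and `ℂ ⊗_ℚ E^ι ≅ ℂ^{ι × Hom(E,ℂ)}` (`coords`). In these coordinates complex
  conjugation is entrywise (`coords_conj`, `E` totally real), `e ∈ E` multiplies the
  `(i, τ)`-entry by `τ(e)` (`coords_lsmul`; so `W_σ` = the vectors supported on `τ = σ`, spanned
  by `eigVec σ i`), and the bilinear form `B = Tr_{E/ℚ}(∑ αᵢ xᵢ yᵢ)` of `T_E(⟨α⟩)` (`trForm`,
  `associated_transfer`) becomes `∑_{i,τ} τ(αᵢ) x_{iτ} y_{iτ}` (`trForm_baseChange_eq`,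
  `Tr = ∑_τ τ`); on `W_σ` it is the printed form `∑ σ(αᵢ) xᵢ yᵢ` of `W_{σ,ℂ} ≅ ℂ^m`.
* **"`ω` in an eigenspace of some `f ∉ E`"** is made precise by the DESCENT LEMMA
  `exists_eq_lsmul_of_baseChange_eigVec`: a rational `f ∈ End_ℚ(E^ι)` whose complexification is a
  scalar `c` on all of `W_σ` is multiplication by some `e ∈ E`. (Proof: the commutators
  `[f, e']` kill `W_σ`, and a rational map killing `W_σ` is zero —
  `eq_zero_of_baseChange_eigVec_eq_zero`, by trace-form duality on `E^ι`
  (`exists_functional_eq_trForm`, Mathlib `traceForm_nondegenerate`): the functional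
  `Tr⟨c', ·⟩` takes the value `σ(c'_j)` on the `j`-th `σ`-eigenvector; so `f` is `E`-linear, a
  matrix `(F_{ij})` over `E`, and `σ(F_{ij}) = c δ_{ij}` forces `F = e · 1`.) Hence for `f ∉ E` and
  any `c ∈ ℂ`, `Ker(f_ℂ - c) ∩ W_σ` is a PROPER subspace of `W_σ` — the printed "lower-dimensional
  eigenspaces", of which there are countably many (`End_ℚ(E^m)` is countable,
  `countable_moduleEnd`; each `f_ℂ` has finitely many eigenvalues, Mathlib
  `Module.End.finite_hasEigenvalue`).
* **"Very general `ω ∈ Q⁺`"** is rendered without Baire category by an explicit algebraic curve in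
  `Q` (§`Curve`): with `aᵢ = σ(αᵢ)`, `a_{i₁}, a_{i₂} > 0` (two of the positive weights) and
  `J = {i ≠ i₁, i₂} ≠ ∅` (`m ≥ 3`), put `R(X) = ∑_{i∈J} aᵢ X^{2nᵢ}` with distinct odd `nᵢ`, and
  `w_{i₁} = (1 - R)/(2√a_{i₁})`, `w_{i₂} = i (1 + R)/(2√a_{i₂})`, `wᵢ = X^{nᵢ}` (`i ∈ J`)
  (`Wpoly`, `wcurve`). Then `∑ aᵢ wᵢ(t)² = 0` identically (`sum_mul_wcurve_sq`: `ω(t) ∈ Q`),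
  `∑ aᵢ |wᵢ(t)|² = (1 + R(t))²/2` for real `t` (`sum_mul_wcurve_conj`: `ω(t) ∈ Q⁺` unless
  `R(t) = -1`, finitely many `t`), and the `wᵢ` are linearly independent polynomials
  (`linearIndependent_Wpoly`, by comparing the coefficients of `X^0`, `X^{2n_j}`, `X^{n_l}`), so
  the curve `ω(t) = ∑ wᵢ(t) · eigVec σ i` (`periodVec`) meets each proper subspace
  `Ker(f_ℂ - c) ∩ W_σ` in finitely many `t` (`finite_setOf_baseChange_periodVec_eq_smul`, via a
  linear functional non-zero on some `(f_ℂ - c) eigVec σ i` and finiteness of the real zeros of a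
  non-zero complex polynomial). The bad parameters form a countable subset of `ℝ`, which is
  uncountable (Mathlib `Cardinal.not_countable_real`); any good `t` gives `ω = ω(t) ∈ Q⁺` with
  `A_T = E` (`BFvGS2025_exists_pseudoPolarization_endAlg_eq_holds`).

Design: no new named facts and no `sorry` (D-0026/D-0014); the definitions introduced
(`periodF`, `ofPeriod`, `embCoords`, `coords`, `trForm`, `eigVec`, the curve data `nexp`, `Jset`,
`RX`, `Rfun`, `cst₁`, `cst₂`, `Wpoly`, `wcurve`, and `kFin`, `periodVec`) are real definitions
serving this proof; `ofPeriod` is the general "Hodge structure of K3 type of a period vector"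
(surjectivity-of-the-period-map shape, §2.1 of the source) and may be reused.

## References

* [BayerFluckigerVanGeemenSchuett2025] E. Bayer-Fluckiger, B. van Geemen, M. Schütt,
  *Non-projective K3 surfaces with real or Salem multiplication*, arXiv:2511.19970 (2025),
  Def. 2.5, Def. 3.2, Lemma 3.1, Thm. 7.1 (pp. 6–8, 14 of the materialised text).
* [Huybrechts2016K3] D. Huybrechts, *Lectures on K3 Surfaces*, CUP 2016, Ch. 3 (K3 type, the
  endomorphism algebra; carriers `IsOfK3Type`, `endAlg`).
-/

open scoped TensorProduct

noncomputable section

namespace Literature.AlgebraicGeometry.Motives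

namespace HodgeStructure

universe u

section Period

variable {V : Type u} [AddCommGroup V] [Module ℚ V]

/-! ### The Hodge structure of K3 type defined by a period vector -/

/-- The filtration defined by a period vector `ω ∈ V_ℂ` and a rational bilinear form `B`:
`F^p = V_ℂ` for `p ≤ 0`, `F^1 = {x | B_ℂ(ω, x) = 0}`, `F^2 = ℂ ω`, `F^p = 0` for `p ≥ 3`.
[cite: BayerFluckigerVanGeemenSchuett2025, Thm. 7.1] -/
def periodF (B : LinearMap.BilinForm ℚ V) (ω : ℂ ⊗[ℚ] V) (p : ℤ) : Submodule ℂ (ℂ ⊗[ℚ] V) :=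
  if p ≤ 0 then ⊤ else if p = 1 then LinearMap.ker (B.baseChange ℂ ω)
    else if p = 2 then ℂ ∙ ω else ⊥

variable (B : LinearMap.BilinForm ℚ V) (ω : ℂ ⊗[ℚ] V)

/-- `F^p = V_ℂ` for `p ≤ 0`. [cite: BayerFluckigerVanGeemenSchuett2025, Thm. 7.1] -/
theorem periodF_of_le_zero {p : ℤ} (hp : p ≤ 0) : periodF B ω p = ⊤ := if_pos hp

/-- `F^1 = ω^⊥ = {x | B_ℂ(ω, x) = 0}` (`= T^{2,0} ⊕ T^{1,1}`).
[cite: BayerFluckigerVanGeemenSchuett2025, Thm. 7.1] -/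
theorem periodF_one : periodF B ω 1 = LinearMap.ker (B.baseChange ℂ ω) := by
  simp [periodF]

/-- `F^2 = ℂ ω = T^{2,0}`. [cite: BayerFluckigerVanGeemenSchuett2025, Thm. 7.1] -/
theorem periodF_two : periodF B ω 2 = ℂ ∙ ω := by
  simp [periodF]

/-- `F^p = 0` for `p ≥ 3`. [cite: BayerFluckigerVanGeemenSchuett2025, Thm. 7.1] -/
theorem periodF_of_three_le {p : ℤ} (hp : 3 ≤ p) : periodF B ω p = ⊥ := by
  have h0 : ¬p ≤ 0 := by omega
  have h1 : p ≠ 1 := by omega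
  have h2 : p ≠ 2 := by omega
  simp [periodF, h0, h1, h2]

/-- Membership in `F^1 = ω^⊥`. [cite: BayerFluckigerVanGeemenSchuett2025, Thm. 7.1] -/
theorem mem_periodF_one {x : ℂ ⊗[ℚ] V} : x ∈ periodF B ω 1 ↔ B.baseChange ℂ ω x = 0 := by
  rw [periodF_one, LinearMap.mem_ker]

/-- Membership in `F^2 = ℂ ω`. [cite: BayerFluckigerVanGeemenSchuett2025, Thm. 7.1] -/
theorem mem_periodF_two {x : ℂ ⊗[ℚ] V} : x ∈ periodF B ω 2 ↔ ∃ c : ℂ, c • ω = x := by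
  rw [periodF_two, Submodule.mem_span_singleton]

variable {B ω}

/-- The period filtration is decreasing as soon as `(ω, ω) = 0` (`ℂ ω ⊆ ω^⊥`).
[cite: BayerFluckigerVanGeemenSchuett2025, Thm. 7.1] -/
theorem antitone_periodF (h0 : B.baseChange ℂ ω ω = 0) : Antitone (periodF B ω) := by
  intro p q hpq
  -- goal: `periodF B ω q ≤ periodF B ω p`
  by_cases hp : p ≤ 0
  · rw [periodF_of_le_zero B ω hp]; exact le_top
  by_cases hq3 : 3 ≤ q
  · rw [periodF_of_three_le B ω hq3]; exact bot_le
  by_cases hp1 : p = 1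
  · subst hp1
    rcases (show q = 1 ∨ q = 2 by omega) with rfl | rfl
    · exact le_rfl
    · rw [periodF_two, periodF_one]
      intro x hx
      obtain ⟨c, rfl⟩ := Submodule.mem_span_singleton.1 hx
      rw [LinearMap.mem_ker, map_smul, h0, smul_zero]
  · obtain rfl : p = 2 := by omega
    obtain rfl : q = 2 := by omega
    exact le_rfl

/-- `conj (F^1) = {x | B_ℂ(conj ω, x) = 0}`. [folklore] -/
theorem mem_complexConj_periodF_one {x : ℂ ⊗[ℚ] V} :
    x ∈ complexConj (periodF B ω 1) ↔ B.baseChange ℂ (conj ω) x = 0 := by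
  rw [mem_complexConj, mem_periodF_one]
  conv_lhs => rw [← conj_conj ω, form_baseChange_conj, map_eq_zero]

/-- `conj (F^2) = ℂ conj ω`. [folklore] -/
theorem mem_complexConj_periodF_two {x : ℂ ⊗[ℚ] V} :
    x ∈ complexConj (periodF B ω 2) ↔ ∃ c : ℂ, c • conj ω = x := by
  rw [mem_complexConj, mem_periodF_two]
  constructor
  · rintro ⟨c, hc⟩
    refine ⟨starRingEnd ℂ c, ?_⟩
    rw [← conj_smul, hc, conj_conj]
  · rintro ⟨c, rfl⟩
    exact ⟨starRingEnd ℂ c, by rw [conj_smul, conj_conj]⟩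

/-- `(ω, conj ω) ≠ 0` implies `(conj ω, ω) ≠ 0` (conjugate the value). [folklore] -/
theorem form_conj_self_ne_zero (h1 : B.baseChange ℂ ω (conj ω) ≠ 0) :
    B.baseChange ℂ (conj ω) ω ≠ 0 := by
  intro h
  apply h1
  have := form_baseChange_conj B (conj ω) ω
  rw [conj_conj] at this
  rw [this, h, map_zero]

/-- `F^2 ⊕ conj F^1 = V_ℂ`, i.e. `ℂ ω ⊕ (conj ω)^⊥ = V_ℂ`, from `(ω, conj ω) ≠ 0`.
[cite: BayerFluckigerVanGeemenSchuett2025, Thm. 7.1] -/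
theorem isCompl_periodF_two_one (h1 : B.baseChange ℂ ω (conj ω) ≠ 0) :
    IsCompl (periodF B ω 2) (complexConj (periodF B ω 1)) := by
  have h1' := form_conj_self_ne_zero h1
  refine ⟨?_, ?_⟩
  · rw [Submodule.disjoint_def]
    intro x hx hx'
    obtain ⟨c, rfl⟩ := (mem_periodF_two B ω).1 hx
    rw [mem_complexConj_periodF_one, map_smul, smul_eq_mul, mul_eq_zero] at hx'
    rcases hx' with hc | h
    · rw [hc, zero_smul]
    · exact absurd h h1'
  · rw [codisjoint_iff, eq_top_iff]
    rintro x -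
    set t : ℂ := B.baseChange ℂ (conj ω) x / B.baseChange ℂ (conj ω) ω with ht
    have hx : x = t • ω + (x - t • ω) := by abel
    rw [hx]
    refine Submodule.add_mem_sup ((mem_periodF_two B ω).2 ⟨t, rfl⟩) ?_
    rw [mem_complexConj_periodF_one, map_sub, map_smul, smul_eq_mul, ht,
      div_mul_cancel₀ _ h1', sub_self]

/-- `F^1 ⊕ conj F^2 = V_ℂ`, i.e. `ω^⊥ ⊕ ℂ conj ω = V_ℂ`, from `(ω, conj ω) ≠ 0`.
[cite: BayerFluckigerVanGeemenSchuett2025, Thm. 7.1] -/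
theorem isCompl_periodF_one_two (h1 : B.baseChange ℂ ω (conj ω) ≠ 0) :
    IsCompl (periodF B ω 1) (complexConj (periodF B ω 2)) := by
  refine ⟨?_, ?_⟩
  · rw [Submodule.disjoint_def]
    intro x hx hx'
    obtain ⟨c, rfl⟩ := mem_complexConj_periodF_two.1 hx'
    rw [mem_periodF_one, map_smul, smul_eq_mul, mul_eq_zero] at hx
    rcases hx with hc | h
    · rw [hc, zero_smul]
    · exact absurd h h1
  · rw [codisjoint_iff, eq_top_iff]
    rintro x -
    set t : ℂ := B.baseChange ℂ ω x / B.baseChange ℂ ω (conj ω) with ht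
    have hx : x = (x - t • conj ω) + t • conj ω := by abel
    rw [hx]
    refine Submodule.add_mem_sup ?_ (mem_complexConj_periodF_two.2 ⟨t, rfl⟩)
    rw [mem_periodF_one, map_sub, map_smul, smul_eq_mul, ht, div_mul_cancel₀ _ h1, sub_self]

/-- **The weight-`2` Hodge structure defined by a period vector.**
[cite: BayerFluckigerVanGeemenSchuett2025, Thm. 7.1] -/
def ofPeriod (B : LinearMap.BilinForm ℚ V) (ω : ℂ ⊗[ℚ] V) (h0 : B.baseChange ℂ ω ω = 0)
    (h1 : B.baseChange ℂ ω (conj ω) ≠ 0) : HodgeStructure V 2 where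
  F := periodF B ω
  antitone_F := antitone_periodF h0
  exists_F_eq_top := ⟨0, periodF_of_le_zero B ω le_rfl⟩
  exists_F_eq_bot := ⟨3, periodF_of_three_le B ω le_rfl⟩
  isCompl_F_complexConj p q hpq := by
    by_cases hp : p ≤ 0
    · rw [periodF_of_le_zero B ω hp, periodF_of_three_le B ω (by omega), complexConj_bot]
      exact isCompl_top_bot
    by_cases hp1 : p = 1
    · subst hp1
      obtain rfl : q = 2 := by omega
      exact isCompl_periodF_one_two h1
    by_cases hp2 : p = 2
    · subst hp2
      obtain rfl : q = 1 := by omega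
      exact isCompl_periodF_two_one h1
    · rw [periodF_of_three_le B ω (by omega), periodF_of_le_zero B ω (by omega), complexConj_top]
      exact isCompl_bot_top

section OfPeriod

variable {B : LinearMap.BilinForm ℚ V} {ω : ℂ ⊗[ℚ] V} (h0 : B.baseChange ℂ ω ω = 0)
  (h1 : B.baseChange ℂ ω (conj ω) ≠ 0)

/-- The Hodge filtration of `ofPeriod` is the period filtration.
[cite: BayerFluckigerVanGeemenSchuett2025, Thm. 7.1] -/
@[simp]
theorem ofPeriod_F : (ofPeriod B ω h0 h1).F = periodF B ω := rfl

/-- A period vector with `(ω, conj ω) ≠ 0` is non-zero. [folklore] -/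
theorem ne_zero_of_period (h1 : B.baseChange ℂ ω (conj ω) ≠ 0) : ω ≠ 0 := by
  rintro rfl
  exact h1 (by rw [map_zero, LinearMap.zero_apply])

/-- `V^{2,0} = ℂ ω` ("`T^{2,0} := ℂ ω`"). [cite: BayerFluckigerVanGeemenSchuett2025, Thm. 7.1] -/
theorem piece_two_zero_ofPeriod : (ofPeriod B ω h0 h1).piece 2 0 = ℂ ∙ ω := by
  rw [piece_of_add_eq _ (by norm_num), ofPeriod_F, periodF_of_le_zero B ω le_rfl, complexConj_top,
    inf_top_eq, periodF_two]

/-- Membership in `V^{2,0} = ℂ ω`. [cite: BayerFluckigerVanGeemenSchuett2025, Thm. 7.1] -/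
theorem mem_piece_two_zero_ofPeriod {x : ℂ ⊗[ℚ] V} :
    x ∈ (ofPeriod B ω h0 h1).piece 2 0 ↔ ∃ c : ℂ, c • ω = x := by
  rw [piece_two_zero_ofPeriod, Submodule.mem_span_singleton]

/-- Membership in `V^{0,2} = ℂ conj ω` ("`T^{0,2} := ℂ conj ω`").
[cite: BayerFluckigerVanGeemenSchuett2025, Thm. 7.1] -/
theorem mem_piece_zero_two_ofPeriod {x : ℂ ⊗[ℚ] V} :
    x ∈ (ofPeriod B ω h0 h1).piece 0 2 ↔ ∃ c : ℂ, c • conj ω = x := by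
  rw [piece_of_add_eq _ (by norm_num), ofPeriod_F, periodF_of_le_zero B ω le_rfl,
    Submodule.mem_inf, mem_complexConj_periodF_two]
  exact ⟨fun h => h.2, fun h => ⟨Submodule.mem_top, h⟩⟩

/-- Membership in `V^{1,1} = (T^{2,0} ⊕ T^{0,2})^⊥ = ω^⊥ ∩ (conj ω)^⊥`.
[cite: BayerFluckigerVanGeemenSchuett2025, Thm. 7.1] -/
theorem mem_piece_one_one_ofPeriod {x : ℂ ⊗[ℚ] V} :
    x ∈ (ofPeriod B ω h0 h1).piece 1 1 ↔
      B.baseChange ℂ ω x = 0 ∧ B.baseChange ℂ (conj ω) x = 0 := by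
  rw [piece_of_add_eq _ (by norm_num), Submodule.mem_inf, ofPeriod_F, mem_periodF_one,
    mem_complexConj_periodF_one]

/-- The Hodge structure defined by a period vector is of K3 type.
[cite: BayerFluckigerVanGeemenSchuett2025, Thm. 7.1] -/
theorem isOfK3Type_ofPeriod : (ofPeriod B ω h0 h1).IsOfK3Type := by
  refine ⟨?_, fun p q hpq => ?_⟩
  · rw [hodgeNumber, piece_two_zero_ofPeriod, finrank_span_singleton (ne_zero_of_period h1)]
  · by_cases hs : p + q = 2
    · rw [piece_of_add_eq _ hs, ofPeriod_F]
      rcases le_or_gt 3 p with hp | hp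
      · rw [periodF_of_three_le B ω hp, bot_inf_eq]
      · have hq : 3 ≤ q := by rcases lt_abs.1 hpq with h | h <;> omega
        rw [periodF_of_three_le B ω hq, complexConj_bot, inf_bot_eq]
    · exact piece_eq_bot_of_add_ne _ hs

/-- The complexification of a symmetric rational bilinear form is symmetric. [folklore] -/
theorem form_baseChange_symm {B : LinearMap.BilinForm ℚ V} (hB : ∀ x y, B x y = B y x)
    (x y : ℂ ⊗[ℚ] V) : B.baseChange ℂ x y = B.baseChange ℂ y x := by
  induction x using TensorProduct.induction_on with
  | zero => simp
  | tmul s v =>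
    induction y using TensorProduct.induction_on with
    | zero => simp
    | tmul t w => simp [hB v w, mul_comm s t]
    | add y₁ y₂ hy₁ hy₂ => simp only [map_add, LinearMap.add_apply, hy₁, hy₂]
  | add x₁ x₂ hx₁ hx₂ => simp only [map_add, LinearMap.add_apply, hx₁, hx₂]

open Literature.NumberTheory.QuadraticForms in
/-- The Hodge structure defined by a period vector `ω` with `B_ℂ(ω, ω) = 0`, `B_ℂ(ω, conj ω) > 0`
is pseudo-polarized by `B` as soon as `B` is symmetric of signature `(3, dim V - 3)`.
[cite: BayerFluckigerVanGeemenSchuett2025, Thm. 7.1] -/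
theorem isPseudoPolarization_ofPeriod [Module.Finite ℚ V] (hB : ∀ x y, B x y = B y x)
    (hsig : HasSignature B.toQuadraticMap 3 (Module.finrank ℚ V - 3))
    (hpos : ∃ r : ℝ, 0 < r ∧ B.baseChange ℂ ω (conj ω) = r) :
    (ofPeriod B ω h0 h1).IsPseudoPolarization B where
  isSymm := hB
  hasSignature := hsig
  isOfK3Type := isOfK3Type_ofPeriod h0 h1
  orthogonal_two_zero x hx y hy := by
    obtain ⟨c, rfl⟩ := (mem_piece_two_zero_ofPeriod h0 h1).1 hy
    rw [map_smul, smul_eq_mul, form_baseChange_symm hB x ω,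
      ((mem_piece_one_one_ofPeriod h0 h1).1 hx).1, mul_zero]
  orthogonal_zero_two x hx y hy := by
    obtain ⟨c, rfl⟩ := (mem_piece_zero_two_ofPeriod h0 h1).1 hy
    rw [map_smul, smul_eq_mul, form_baseChange_symm hB x (conj ω),
      ((mem_piece_one_one_ofPeriod h0 h1).1 hx).2, mul_zero]
  isotropic x hx := by
    obtain ⟨c, rfl⟩ := (mem_piece_two_zero_ofPeriod h0 h1).1 hx
    rw [LinearMap.map_smul₂, map_smul, h0, smul_zero, smul_zero]
  pos x hx hx0 := by
    obtain ⟨c, rfl⟩ := (mem_piece_two_zero_ofPeriod h0 h1).1 hx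
    obtain ⟨r, hr, hωr⟩ := hpos
    have hc : c ≠ 0 := by
      rintro rfl
      exact hx0 (zero_smul _ _)
    refine ⟨Complex.normSq c * r, mul_pos (Complex.normSq_pos.2 hc) hr, ?_⟩
    rw [conj_smul, LinearMap.map_smul₂, map_smul, hωr, smul_eq_mul, smul_eq_mul, ← mul_assoc,
      Complex.mul_conj, Complex.ofReal_mul]

/-- A Hodge endomorphism of the Hodge structure defined by `ω` has `ω` as an eigenvector.
[cite: BayerFluckigerVanGeemenSchuett2025, Thm. 7.1] -/
theorem exists_smul_eq_of_mem_endAlg_ofPeriod {a : Module.End ℚ V}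
    (ha : a ∈ (ofPeriod B ω h0 h1).endAlg) : ∃ c : ℂ, a.baseChange ℂ ω = c • ω := by
  have h := ha 2 ⟨ω, (mem_periodF_two B ω).2 ⟨1, one_smul _ _⟩, rfl⟩
  obtain ⟨c, hc⟩ := (mem_periodF_two B ω).1 h
  exact ⟨c, hc.symm⟩

/-- A `B`-self-adjoint endomorphism having `ω` as an eigenvector is a Hodge endomorphism of the
Hodge structure defined by `ω`.
[cite: BayerFluckigerVanGeemenSchuett2025, Thm. 7.1] -/
theorem mem_endAlg_ofPeriod {a : Module.End ℚ V} (hadj : ∀ x y, B (a x) y = B x (a y)) {c : ℂ}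
    (hc : a.baseChange ℂ ω = c • ω) : a ∈ (ofPeriod B ω h0 h1).endAlg := by
  have hadj' : ∀ x y : ℂ ⊗[ℚ] V,
      B.baseChange ℂ (a.baseChange ℂ x) y = B.baseChange ℂ x (a.baseChange ℂ y) := by
    intro x y
    induction x using TensorProduct.induction_on with
    | zero => simp
    | tmul s v =>
      induction y using TensorProduct.induction_on with
      | zero => simp
      | tmul t w => simp [hadj]
      | add y₁ y₂ hy₁ hy₂ => simp only [map_add, hy₁, hy₂]
    | add x₁ x₂ hx₁ hx₂ => simp only [map_add, LinearMap.add_apply, hx₁, hx₂]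
  intro p
  change Submodule.map (a.baseChange ℂ) (periodF B ω p) ≤ periodF B ω p
  by_cases hp : p ≤ 0
  · rw [periodF_of_le_zero B ω hp]; exact le_top
  by_cases hp1 : p = 1
  · subst hp1
    rw [Submodule.map_le_iff_le_comap]
    intro x hx
    rw [Submodule.mem_comap, mem_periodF_one, ← hadj', hc, LinearMap.map_smul₂,
      (mem_periodF_one B ω).1 hx, smul_zero]
  by_cases hp2 : p = 2
  · subst hp2
    rw [Submodule.map_le_iff_le_comap]
    intro x hx
    obtain ⟨d, rfl⟩ := (mem_periodF_two B ω).1 hx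
    rw [Submodule.mem_comap, mem_periodF_two]
    exact ⟨d * c, by rw [map_smul, hc, smul_smul]⟩
  · rw [periodF_of_three_le B ω (by omega), Submodule.map_bot]

end OfPeriod

end Period

namespace RealMult

section Coords

variable (E : Type u) [Field E] [NumberField E]

/-! ### Coordinates on `ℂ ⊗_ℚ E` and on `ℂ ⊗_ℚ E^ι` indexed by the complex embeddings -/

/-- The `ℂ`-linear isomorphism `ℂ ⊗_ℚ E ≃ ℂ^{Hom(E, ℂ)}`, `z ⊗ e ↦ (z · τ(e))_τ` (linear
independence of the embeddings; built from Mathlib's `latticeBasis`).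
[folklore] -/
def embCoords : ℂ ⊗[ℚ] E ≃ₗ[ℂ] ((E →+* ℂ) → ℂ) :=
  (Algebra.TensorProduct.basis ℂ (NumberField.integralBasis E)).equiv
    (NumberField.canonicalEmbedding.latticeBasis E) (Equiv.refl _)

/-- `embCoords (1 ⊗ e) = (τ(e))_τ` (the canonical embedding). [folklore] -/
theorem embCoords_one_tmul (e : E) :
    embCoords E (1 ⊗ₜ e) = NumberField.canonicalEmbedding E e := by
  let f₁ : E →ₗ[ℚ] ((E →+* ℂ) → ℂ) :=
    (embCoords E).toLinearMap.restrictScalars ℚ ∘ₗ TensorProduct.mk ℚ ℂ E 1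
  let f₂ : E →ₗ[ℚ] ((E →+* ℂ) → ℂ) :=
    (NumberField.canonicalEmbedding E).toRatAlgHom.toLinearMap
  have h : f₁ = f₂ := by
    refine (NumberField.integralBasis E).ext fun i => ?_
    change embCoords E (1 ⊗ₜ NumberField.integralBasis E i) =
      NumberField.canonicalEmbedding E (NumberField.integralBasis E i)
    rw [← Algebra.TensorProduct.basis_apply (A := ℂ), embCoords, Module.Basis.equiv_apply,
      Equiv.refl_apply, NumberField.canonicalEmbedding.latticeBasis_apply]
  exact LinearMap.congr_fun h e

/-- `embCoords (z ⊗ e)_τ = z · τ(e)`. [folklore] -/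
theorem embCoords_tmul (z : ℂ) (e : E) (τ : E →+* ℂ) : embCoords E (z ⊗ₜ e) τ = z * τ e := by
  have : z ⊗ₜ[ℚ] e = z • ((1 : ℂ) ⊗ₜ[ℚ] e) := by
    rw [TensorProduct.smul_tmul', smul_eq_mul, mul_one]
  rw [this, map_smul, embCoords_one_tmul, Pi.smul_apply, smul_eq_mul,
    NumberField.canonicalEmbedding.apply_at]

variable (ι : Type) [Fintype ι] [DecidableEq ι]

/-- Coordinates on `ℂ ⊗_ℚ E^ι`: the `ℂ`-linear isomorphism with `ℂ^{ι × Hom(E, ℂ)}`,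
`z ⊗ v ↦ (z · τ(v i))_{i, τ}`.
[folklore] -/
def coords : ℂ ⊗[ℚ] (ι → E) ≃ₗ[ℂ] (ι → (E →+* ℂ) → ℂ) :=
  (TensorProduct.piRight ℚ ℂ ℂ (fun _ : ι => E)).trans
    (LinearEquiv.piCongrRight fun _ => embCoords E)

/-- `coords (z ⊗ v)_{i,τ} = z · τ(vᵢ)`. [folklore] -/
theorem coords_tmul (z : ℂ) (v : ι → E) (i : ι) (τ : E →+* ℂ) :
    coords E ι (z ⊗ₜ v) i τ = z * τ (v i) := by
  simp [coords, embCoords_tmul]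

omit [NumberField E] in
/-- Every complex embedding of a totally real field is real. [folklore] -/
theorem conj_embedding_apply [NumberField.IsTotallyReal E] (τ : E →+* ℂ) (e : E) :
    starRingEnd ℂ (τ e) = τ e := by
  have h := NumberField.ComplexEmbedding.isReal_iff.1
    (NumberField.IsTotallyReal.complexEmbedding_isReal τ)
  have := RingHom.congr_fun h e
  rwa [NumberField.ComplexEmbedding.conjugate_coe_eq] at this

/-- For `E` totally real, complex conjugation on `ℂ ⊗_ℚ E^ι` is coordinatewise conjugation.
[folklore] -/
theorem coords_conj [NumberField.IsTotallyReal E] (x : ℂ ⊗[ℚ] (ι → E)) (i : ι) (τ : E →+* ℂ) :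
    coords E ι (conj x) i τ = starRingEnd ℂ (coords E ι x i τ) := by
  induction x using TensorProduct.induction_on with
  | zero => simp
  | tmul z v => rw [conj_tmul, coords_tmul, coords_tmul, map_mul, conj_embedding_apply]
  | add x y hx hy => simp only [map_add, Pi.add_apply, hx, hy]

/-- The action of `e ∈ E` on `ℂ ⊗_ℚ E^ι` multiplies the `(i, τ)`-coordinate by `τ(e)`. [folklore] -/
theorem coords_lsmul (e : E) (x : ℂ ⊗[ℚ] (ι → E)) (i : ι) (τ : E →+* ℂ) :
    coords E ι ((Algebra.lsmul ℚ ℚ (ι → E) e).baseChange ℂ x) i τ = τ e * coords E ι x i τ := by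
  induction x using TensorProduct.induction_on with
  | zero => simp
  | tmul z v =>
    simp only [LinearMap.baseChange_tmul, coords_tmul, Algebra.lsmul_coe, Pi.smul_apply,
      smul_eq_mul, map_mul]
    ring
  | add x y hx hy => simp only [map_add, Pi.add_apply, hx, hy, mul_add]

/-- `Tr_{E/ℚ}(e) = ∑_τ τ(e)` in `ℂ`. [folklore] -/
theorem algebraMap_trace_eq_sum (e : E) :
    algebraMap ℚ ℂ (Algebra.trace ℚ E e) = ∑ τ : E →+* ℂ, τ e := by
  rw [trace_eq_sum_embeddings ℂ (K := ℚ) (L := E)]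
  exact (Fintype.sum_equiv RingHom.equivRatAlgHom _ _ fun τ => rfl).symm

/-! ### The transfer form in coordinates -/

open Literature.NumberTheory.QuadraticForms

variable {ι}

/-- The trace form `(v, w) ↦ Tr_{E/ℚ}(∑ᵢ αᵢ vᵢ wᵢ)` on `E^ι`, as a rational bilinear form.
[cite: BayerFluckigerVanGeemenSchuett2025, Def. 3.2] -/
def trForm (α : ι → E) : LinearMap.BilinForm ℚ (ι → E) :=
  LinearMap.mk₂ ℚ (fun v w => Algebra.trace ℚ E (∑ i, α i * (v i * w i)))
    (fun v₁ v₂ w => by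
      simp only [Pi.add_apply, mul_add, add_mul, Finset.sum_add_distrib, map_add])
    (fun c v w => by
      simp only [Pi.smul_apply, smul_mul_assoc, mul_smul_comm, ← Finset.smul_sum, map_smul])
    (fun v w₁ w₂ => by
      simp only [Pi.add_apply, mul_add, Finset.sum_add_distrib, map_add])
    (fun c v w => by
      simp only [Pi.smul_apply, mul_smul_comm, ← Finset.smul_sum, map_smul])

omit [DecidableEq ι] in
/-- Unfolding of the trace form. [cite: BayerFluckigerVanGeemenSchuett2025, Def. 3.2] -/
@[simp]
theorem trForm_apply (α : ι → E) (v w : ι → E) :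
    trForm E α v w = Algebra.trace ℚ E (∑ i, α i * (v i * w i)) := rfl

omit [DecidableEq ι] in
/-- The trace form is symmetric. [cite: BayerFluckigerVanGeemenSchuett2025, Def. 3.2] -/
theorem trForm_symm (α : ι → E) (v w : ι → E) : trForm E α v w = trForm E α w v := by
  simp only [trForm_apply, mul_comm (v _) (w _)]

omit [DecidableEq ι] in
/-- The quadratic form of the trace form `Tr(∑ αᵢ xᵢ yᵢ)` is the transfer `T_E(⟨α⟩)`.
[cite: BayerFluckigerVanGeemenSchuett2025, Def. 3.2] -/
theorem toQuadraticMap_trForm (α : ι → E) :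
    (trForm E α).toQuadraticMap = transfer E (QuadraticMap.weightedSumSquares E α) := by
  ext v
  rw [LinearMap.BilinMap.toQuadraticMap_apply, trForm_apply, transfer_apply,
    QuadraticMap.weightedSumSquares_apply]
  simp only [smul_eq_mul]

omit [DecidableEq ι] in
/-- The symmetric bilinear form of the transfer `T_E(⟨α⟩)` is the trace form.
[cite: BayerFluckigerVanGeemenSchuett2025, Def. 3.2] -/
theorem associated_transfer (α : ι → E) :
    QuadraticMap.associated (R := ℚ) (transfer E (QuadraticMap.weightedSumSquares E α)) =
      trForm E α := by
  rw [← toQuadraticMap_trForm]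
  exact QuadraticMap.associated_left_inverse ℚ (trForm_symm E α)

/-- The complexified transfer form in coordinates:
`B_ℂ(x, y) = ∑_{i, τ} τ(αᵢ) x_{iτ} y_{iτ}`.
[cite: BayerFluckigerVanGeemenSchuett2025, Def. 3.2] -/
theorem trForm_baseChange_eq (α : ι → E) (x y : ℂ ⊗[ℚ] (ι → E)) :
    (trForm E α).baseChange ℂ x y =
      ∑ i, ∑ τ : E →+* ℂ, τ (α i) * (coords E ι x i τ * coords E ι y i τ) := by
  induction x using TensorProduct.induction_on with
  | zero => simp
  | tmul z v =>
    induction y using TensorProduct.induction_on with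
    | zero => simp
    | tmul z' w =>
      rw [LinearMap.BilinForm.baseChange_tmul, trForm_apply, Rat.smul_def,
        ← eq_ratCast (algebraMap ℚ ℂ), algebraMap_trace_eq_sum, Finset.sum_mul, Finset.sum_comm]
      refine Finset.sum_congr rfl fun τ _ => ?_
      rw [map_sum, Finset.sum_mul]
      refine Finset.sum_congr rfl fun i _ => ?_
      rw [coords_tmul, coords_tmul, map_mul, map_mul]
      ring
    | add y₁ y₂ hy₁ hy₂ =>
      simp only [map_add, Pi.add_apply, hy₁, hy₂, mul_add, Finset.sum_add_distrib]
  | add x₁ x₂ hx₁ hx₂ =>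
    simp only [map_add, LinearMap.add_apply, Pi.add_apply, hx₁, hx₂, add_mul, mul_add,
      Finset.sum_add_distrib]

/-! ### The `σ`-eigenvectors and the descent lemma -/

variable (ι)

open scoped Classical in
/-- The standard vectors spanning the `σ`-eigenspace `W_σ ⊂ ℂ ⊗ E^ι`: the vector with
coordinates `δ_{ij} δ_{τσ}`.
[folklore] -/
def eigVec (σ : E →+* ℂ) (j : ι) : ℂ ⊗[ℚ] (ι → E) :=
  (coords E ι).symm (Pi.single j (Pi.single σ 1))

open scoped Classical in
/-- Coordinates of the `σ`-eigenvectors. [folklore] -/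
@[simp]
theorem coords_eigVec (σ : E →+* ℂ) (j : ι) :
    coords E ι (eigVec E ι σ j) = Pi.single j (Pi.single σ 1) := by
  simp [eigVec]

open scoped Classical in
/-- Coordinates of the `σ`-eigenvectors, entrywise. [folklore] -/
theorem coords_eigVec_apply (σ : E →+* ℂ) (j i : ι) (τ : E →+* ℂ) :
    coords E ι (eigVec E ι σ j) i τ = if i = j then (if τ = σ then 1 else 0) else 0 := by
  rw [coords_eigVec]
  by_cases hij : i = j
  · subst hij
    rw [Pi.single_eq_same, if_pos rfl, Pi.single_apply]
  · rw [Pi.single_eq_of_ne hij, if_neg hij, Pi.zero_apply]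

/-- The `σ`-eigenvectors are non-zero. [folklore] -/
theorem eigVec_ne_zero (σ : E →+* ℂ) (j : ι) : eigVec E ι σ j ≠ 0 := by
  intro h
  have := congrArg (fun x => coords E ι x j σ) h
  simp only [coords_eigVec_apply, map_zero, Pi.zero_apply] at this
  exact one_ne_zero this

/-- `E` acts on the `σ`-eigenvectors through `σ`. [folklore] -/
theorem lsmul_baseChange_eigVec (σ : E →+* ℂ) (e : E) (j : ι) :
    (Algebra.lsmul ℚ ℚ (ι → E) e).baseChange ℂ (eigVec E ι σ j) = σ e • eigVec E ι σ j := by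
  apply (coords E ι).injective
  funext i τ
  rw [coords_lsmul, map_smul, Pi.smul_apply, Pi.smul_apply, smul_eq_mul, coords_eigVec_apply]
  split_ifs with h1 h2
  · rw [h2]
  · rw [mul_zero, mul_zero]
  · rw [mul_zero, mul_zero]

variable {ι}

/-- Trace-form duality on `E^ι`: every rational linear functional is `v ↦ Tr(∑ᵢ cᵢ vᵢ)`. [folklore]
-/
theorem exists_functional_eq_trForm (φ : (ι → E) →ₗ[ℚ] ℚ) :
    ∃ c : ι → E, ∀ v, φ v = trForm E 1 c v := by
  have hnd := traceForm_nondegenerate ℚ E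
  refine ⟨fun i => ((Algebra.traceForm ℚ E).toDual hnd).symm
    (φ ∘ₗ LinearMap.single ℚ (fun _ : ι => E) i), fun v => ?_⟩
  rw [trForm_apply]
  simp only [Pi.one_apply, one_mul]
  conv_lhs => rw [← Finset.univ_sum_single v, map_sum]
  rw [map_sum]
  refine Finset.sum_congr rfl fun i _ => ?_
  rw [← Algebra.traceForm_apply, LinearMap.BilinForm.apply_toDual_symm_apply]
  rfl

/-- **(L1)** A rational endomorphism of `E^ι` whose complexification kills the `σ`-eigenvectors
is zero: the eigenspace `W_σ` is contained in no proper rational subspace.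
[folklore] -/
theorem eq_zero_of_baseChange_eigVec_eq_zero (σ : E →+* ℂ) (g : Module.End ℚ (ι → E))
    (hg : ∀ j, g.baseChange ℂ (eigVec E ι σ j) = 0) : g = 0 := by
  -- Step 1: for every `c`, the functional `v ↦ Tr⟨c, g v⟩` vanishes.
  have key : ∀ c v, trForm E 1 c (g v) = 0 := by
    intro c
    obtain ⟨c', hc'⟩ := exists_functional_eq_trForm E (trForm E 1 c ∘ₗ g)
    have hC : ∀ x : ℂ ⊗[ℚ] (ι → E), (trForm E 1).baseChange ℂ (1 ⊗ₜ c) (g.baseChange ℂ x) =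
        (trForm E 1).baseChange ℂ (1 ⊗ₜ c') x := by
      intro x
      induction x using TensorProduct.induction_on with
      | zero => simp
      | tmul z v =>
        rw [LinearMap.baseChange_tmul, LinearMap.BilinForm.baseChange_tmul,
          LinearMap.BilinForm.baseChange_tmul, ← hc']
        rfl
      | add x y hx hy => simp only [map_add, hx, hy]
    have hc'0 : c' = 0 := by
      funext j
      have h := hC (eigVec E ι σ j)
      rw [hg j, map_zero, trForm_baseChange_eq] at h
      simp only [Pi.one_apply, map_one, one_mul, coords_tmul, coords_eigVec_apply, mul_ite,
        mul_one, mul_zero, Finset.sum_ite_eq', Finset.mem_univ, if_true, Finset.sum_ite_irrel,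
        Finset.sum_const_zero] at h
      rw [Finset.sum_eq_single σ (fun τ _ hτ => if_neg hτ)
        (fun h' => absurd (Finset.mem_univ σ) h'), if_pos rfl] at h
      exact (map_eq_zero σ).1 h.symm
    intro v
    have := hc' v
    rw [hc'0] at this
    simpa using this
  -- Step 2: nondegeneracy of the trace form, coordinate by coordinate.
  refine LinearMap.ext fun v => funext fun i => ?_
  rw [LinearMap.zero_apply, Pi.zero_apply]
  refine (traceForm_nondegenerate ℚ E).1 (g v i) fun e => ?_
  have h := key (Pi.single i e) v
  rw [trForm_apply] at h
  simp only [Pi.one_apply, one_mul, Pi.single_apply, ite_mul, zero_mul, Finset.sum_ite_eq',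
    Finset.mem_univ, if_true] at h
  rw [Algebra.traceForm_apply, mul_comm]
  exact h

/-- **The descent lemma.** A rational endomorphism of `E^ι` whose complexification acts on the
`σ`-eigenvectors by a scalar is multiplication by an element of `E`.
[folklore] -/
theorem exists_eq_lsmul_of_baseChange_eigVec [Nonempty ι] (σ : E →+* ℂ)
    (f : Module.End ℚ (ι → E)) (c : ℂ)
    (hf : ∀ j, f.baseChange ℂ (eigVec E ι σ j) = c • eigVec E ι σ j) :
    ∃ e : E, f = Algebra.lsmul ℚ ℚ (ι → E) e := by
  -- Step 1: `f` commutes with the `E`-action (by (L1) applied to the commutator).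
  have hcomm : ∀ e : E, f * Algebra.lsmul ℚ ℚ (ι → E) e = Algebra.lsmul ℚ ℚ (ι → E) e * f := by
    intro e
    rw [← sub_eq_zero]
    apply eq_zero_of_baseChange_eigVec_eq_zero E σ
    intro j
    rw [LinearMap.baseChange_sub, LinearMap.sub_apply, Module.End.mul_eq_comp,
      Module.End.mul_eq_comp, LinearMap.baseChange_comp, LinearMap.baseChange_comp,
      LinearMap.comp_apply, LinearMap.comp_apply, lsmul_baseChange_eigVec, map_smul, hf,
      map_smul, lsmul_baseChange_eigVec, smul_comm, sub_self]
  have hlin : ∀ (e : E) (v : ι → E), f (e • v) = e • f v := fun e v => by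
    simpa using LinearMap.congr_fun (hcomm e) v
  -- Step 2: `f` is given by a matrix `F i j := f (single j 1) i` over `E`.
  have hfv : ∀ v i, f v i = ∑ j, f (Pi.single j 1) i * v j := by
    intro v i
    conv_lhs => rw [← Finset.univ_sum_single v, map_sum]
    rw [Finset.sum_apply]
    refine Finset.sum_congr rfl fun j _ => ?_
    have : (Pi.single j (v j) : ι → E) = v j • (Pi.single j (1 : E) : ι → E) := by
      rw [← Pi.single_smul, smul_eq_mul, mul_one]
    rw [this, hlin, Pi.smul_apply, smul_eq_mul, mul_comm]
  -- Step 3: in coordinates, `f_ℂ` is the matrix `(τ (F i j))`.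
  have hcoordsF : ∀ x i τ, coords E ι (f.baseChange ℂ x) i τ =
      ∑ j, τ (f (Pi.single j 1) i) * coords E ι x j τ := by
    intro x i τ
    induction x using TensorProduct.induction_on with
    | zero => simp
    | tmul z v =>
      rw [LinearMap.baseChange_tmul, coords_tmul, hfv, map_sum, Finset.mul_sum]
      refine Finset.sum_congr rfl fun j _ => ?_
      rw [coords_tmul, map_mul]
      ring
    | add x y hx hy => simp only [map_add, Pi.add_apply, hx, hy, mul_add, Finset.sum_add_distrib]
  -- Step 4: read off `σ (F i j) = c δ_ij`.
  have hF : ∀ i j, σ (f (Pi.single j 1) i) = if i = j then c else 0 := by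
    intro i j
    have h := congrArg (fun x => coords E ι x i σ) (hf j)
    simp only [hcoordsF, map_smul, Pi.smul_apply, smul_eq_mul, coords_eigVec_apply,
      mul_ite, mul_one, mul_zero, Finset.sum_ite_eq', Finset.mem_univ, if_true] at h
    exact h
  -- Step 5: conclude.
  obtain ⟨i₀⟩ := ‹Nonempty ι›
  refine ⟨f (Pi.single i₀ 1) i₀, LinearMap.ext fun v => funext fun i => ?_⟩
  rw [hfv, Algebra.lsmul_coe]
  change _ = (f (Pi.single i₀ 1) i₀ • v) i
  rw [Pi.smul_apply, smul_eq_mul, Finset.sum_eq_single i]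
  · congr 1
    apply σ.injective
    rw [hF, hF, if_pos rfl, if_pos rfl]
  · intro j _ hji
    have h := hF i j
    rw [if_neg (Ne.symm hji), map_eq_zero] at h
    rw [h, zero_mul]
  · intro h
    exact absurd (Finset.mem_univ i) h

end Coords

open Polynomial

/-! ### A polynomial curve on the quadric `∑ aᵢ wᵢ² = 0` with linearly independent coordinates -/

section Constants

variable {ι : Type} (a : ι → ℝ) (i₁ i₂ : ι) (k : ι → ℕ)

/-- The odd exponents `nᵢ = 2 kᵢ + 1`. [folklore] -/
def nexp (i : ι) : ℕ := 2 * k i + 1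

/-- The exponents are positive. [folklore] -/
theorem nexp_pos (i : ι) : 0 < nexp k i := by unfold nexp; omega

/-- An odd exponent is not twice another. [folklore] -/
theorem nexp_ne_two_mul (i j : ι) : nexp k i ≠ 2 * nexp k j := by unfold nexp; omega

/-- Twice an exponent is non-zero. [folklore] -/
theorem two_mul_nexp_ne_zero (i : ι) : 2 * nexp k i ≠ 0 := by unfold nexp; omega

/-- The exponents are distinct when `k` is injective. [folklore] -/
theorem nexp_injective (hk : Function.Injective k) : Function.Injective (nexp k) := by
  intro i j h
  unfold nexp at h
  exact hk (by omega)

/-- The constants `c₁ = 1 / (2 √a₁)` and `c₂ = i / (2 √a₂)`. [folklore] -/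
def cst₁ : ℂ := ((2 * Real.sqrt (a i₁))⁻¹ : ℝ)

/-- See `cst₁`. [folklore] -/
def cst₂ : ℂ := ((2 * Real.sqrt (a i₂))⁻¹ : ℝ) * Complex.I

/-- `a₁ c₁² = 1/4`. [folklore] -/
theorem mul_cst₁_sq (ha : 0 < a i₁) : (a i₁ : ℂ) * (cst₁ a i₁ * cst₁ a i₁) = 1 / 4 := by
  have hs : Real.sqrt (a i₁) ^ 2 = a i₁ := Real.sq_sqrt ha.le
  have hs0 : Real.sqrt (a i₁) ≠ 0 := (Real.sqrt_pos.2 ha).ne'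
  rw [cst₁, ← Complex.ofReal_mul, ← Complex.ofReal_mul]
  rw [show a i₁ * ((2 * Real.sqrt (a i₁))⁻¹ * (2 * Real.sqrt (a i₁))⁻¹) = 1 / 4 by
    field_simp; rw [hs]; ring]
  push_cast; ring

/-- `a₁ |c₁|² = 1/4`. [folklore] -/
theorem mul_cst₁_conj (ha : 0 < a i₁) :
    (a i₁ : ℂ) * (cst₁ a i₁ * starRingEnd ℂ (cst₁ a i₁)) = 1 / 4 := by
  rw [cst₁, Complex.conj_ofReal, ← cst₁, mul_cst₁_sq a i₁ ha]

/-- `a₂ c₂² = -1/4`. [folklore] -/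
theorem mul_cst₂_sq (ha : 0 < a i₂) : (a i₂ : ℂ) * (cst₂ a i₂ * cst₂ a i₂) = -(1 / 4) := by
  have hs : Real.sqrt (a i₂) ^ 2 = a i₂ := Real.sq_sqrt ha.le
  have hs0 : Real.sqrt (a i₂) ≠ 0 := (Real.sqrt_pos.2 ha).ne'
  have key : (a i₂ : ℂ) * (((2 * Real.sqrt (a i₂))⁻¹ : ℝ) * ((2 * Real.sqrt (a i₂))⁻¹ : ℝ)) =
      1 / 4 := by
    rw [← Complex.ofReal_mul, ← Complex.ofReal_mul]
    rw [show a i₂ * ((2 * Real.sqrt (a i₂))⁻¹ * (2 * Real.sqrt (a i₂))⁻¹) = 1 / 4 by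
      field_simp; rw [hs]; ring]
    push_cast; ring
  rw [cst₂]
  calc (a i₂ : ℂ) * (((2 * Real.sqrt (a i₂))⁻¹ : ℝ) * Complex.I * (((2 * Real.sqrt (a i₂))⁻¹ : ℝ) *
      Complex.I)) = (a i₂ : ℂ) * (((2 * Real.sqrt (a i₂))⁻¹ : ℝ) * ((2 * Real.sqrt (a i₂))⁻¹ : ℝ)) *
      (Complex.I * Complex.I) := by ring
    _ = -(1 / 4) := by rw [key, Complex.I_mul_I]; ring

/-- `a₂ |c₂|² = 1/4`. [folklore] -/
theorem mul_cst₂_conj (ha : 0 < a i₂) :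
    (a i₂ : ℂ) * (cst₂ a i₂ * starRingEnd ℂ (cst₂ a i₂)) = 1 / 4 := by
  have h := mul_cst₂_sq a i₂ ha
  rw [cst₂, map_mul, Complex.conj_ofReal, Complex.conj_I]
  rw [cst₂] at h
  linear_combination (-1 : ℂ) * h

/-- `c₁ ≠ 0`. [folklore] -/
theorem cst₁_ne_zero (ha : 0 < a i₁) : cst₁ a i₁ ≠ 0 := by
  rw [cst₁, Complex.ofReal_ne_zero]
  exact inv_ne_zero (mul_ne_zero two_ne_zero (Real.sqrt_pos.2 ha).ne')

/-- `c₂ ≠ 0`. [folklore] -/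
theorem cst₂_ne_zero (ha : 0 < a i₂) : cst₂ a i₂ ≠ 0 := by
  rw [cst₂]
  refine mul_ne_zero ?_ Complex.I_ne_zero
  rw [Complex.ofReal_ne_zero]
  exact inv_ne_zero (mul_ne_zero two_ne_zero (Real.sqrt_pos.2 ha).ne')

end Constants

section Curve

variable {ι : Type} [Fintype ι] [DecidableEq ι] (a : ι → ℝ) (i₁ i₂ : ι) (k : ι → ℕ)

/-- The indices other than the two distinguished (positive) ones. [folklore] -/
def Jset : Finset ι := Finset.univ \ {i₁, i₂}

/-- Membership in `J = ι ∖ {i₁, i₂}`. [folklore] -/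
theorem mem_Jset {i : ι} : i ∈ Jset i₁ i₂ ↔ i ≠ i₁ ∧ i ≠ i₂ := by
  simp [Jset, not_or]

/-- Splitting a sum over `ι` into the two distinguished indices and `J`. [folklore] -/
theorem sum_univ_eq_add_add_sum_Jset {M : Type*} [AddCommMonoid M] (h12 : i₁ ≠ i₂) (F : ι → M) :
    ∑ i, F i = F i₁ + F i₂ + ∑ i ∈ Jset i₁ i₂, F i := by
  rw [Jset, ← Finset.sum_sdiff (Finset.subset_univ {i₁, i₂}), Finset.sum_pair h12, add_comm]

/-- `R(X) = ∑_{i ∈ J} aᵢ X^{2nᵢ}` (complex coefficients). [folklore] -/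
def RX : ℂ[X] := ∑ i ∈ Jset i₁ i₂, C (a i : ℂ) * X ^ (2 * nexp k i)

/-- `R(t) = ∑_{i ∈ J} aᵢ t^{2nᵢ}` as a real function. [folklore] -/
def Rfun (t : ℝ) : ℝ := ∑ i ∈ Jset i₁ i₂, a i * t ^ (2 * nexp k i)

/-- `R(X)` evaluates at real `t` to the real number `R(t)`. [folklore] -/
theorem RX_eval (t : ℝ) : (RX a i₁ i₂ k).eval (t : ℂ) = (Rfun a i₁ i₂ k t : ℂ) := by
  simp only [RX, Rfun, eval_finsetSum, eval_mul, eval_C, eval_pow, eval_X, Complex.ofReal_sum,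
    Complex.ofReal_mul, Complex.ofReal_pow]

/-- The coordinate polynomials `Wᵢ(X)`: `c₁ (1 - R)`, `c₂ (1 + R)` at the two distinguished
indices and `X^{nᵢ}` elsewhere.
[folklore] -/
def Wpoly (i : ι) : ℂ[X] :=
  if i = i₁ then C (cst₁ a i₁) * (1 - RX a i₁ i₂ k)
  else if i = i₂ then C (cst₂ a i₂) * (1 + RX a i₁ i₂ k) else X ^ nexp k i

/-- The curve `t ↦ w(t) = (Wᵢ(t))ᵢ ∈ ℂ^ι`, `t ∈ ℝ`. [folklore] -/
def wcurve (t : ℝ) (i : ι) : ℂ := (Wpoly a i₁ i₂ k i).eval (t : ℂ)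

/-- `W_{i₁} = c₁ (1 - R)`. [folklore] -/
theorem Wpoly_i₁ : Wpoly a i₁ i₂ k i₁ = C (cst₁ a i₁) * (1 - RX a i₁ i₂ k) := if_pos rfl

/-- `W_{i₂} = c₂ (1 + R)`. [folklore] -/
theorem Wpoly_i₂ (h12 : i₁ ≠ i₂) : Wpoly a i₁ i₂ k i₂ = C (cst₂ a i₂) * (1 + RX a i₁ i₂ k) := by
  rw [Wpoly, if_neg h12.symm, if_pos rfl]

/-- `Wᵢ = X^{nᵢ}` for `i ∈ J`. [folklore] -/
theorem Wpoly_of_mem {i : ι} (hi : i ∈ Jset i₁ i₂) : Wpoly a i₁ i₂ k i = X ^ nexp k i := by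
  rw [mem_Jset] at hi
  rw [Wpoly, if_neg hi.1, if_neg hi.2]

/-- `w_{i₁}(t) = c₁ (1 - R(t))`. [folklore] -/
theorem wcurve_i₁ (t : ℝ) : wcurve a i₁ i₂ k t i₁ = cst₁ a i₁ * (1 - Rfun a i₁ i₂ k t) := by
  rw [wcurve, Wpoly_i₁, eval_mul, eval_C, eval_sub, eval_one, RX_eval]

/-- `w_{i₂}(t) = c₂ (1 + R(t))`. [folklore] -/
theorem wcurve_i₂ (h12 : i₁ ≠ i₂) (t : ℝ) :
    wcurve a i₁ i₂ k t i₂ = cst₂ a i₂ * (1 + Rfun a i₁ i₂ k t) := by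
  rw [wcurve, Wpoly_i₂ a i₁ i₂ k h12, eval_mul, eval_C, eval_add, eval_one, RX_eval]

/-- `wᵢ(t) = t^{nᵢ}` (real) for `i ∈ J`. [folklore] -/
theorem wcurve_of_mem {i : ι} (hi : i ∈ Jset i₁ i₂) (t : ℝ) :
    wcurve a i₁ i₂ k t i = ((t ^ nexp k i : ℝ) : ℂ) := by
  rw [wcurve, Wpoly_of_mem a i₁ i₂ k hi, eval_pow, eval_X, Complex.ofReal_pow]

/-- **The curve lies on the quadric:** `∑ᵢ aᵢ wᵢ(t)² = 0`. [folklore] -/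
theorem sum_mul_wcurve_sq (h12 : i₁ ≠ i₂) (ha₁ : 0 < a i₁) (ha₂ : 0 < a i₂) (t : ℝ) :
    ∑ i, (a i : ℂ) * (wcurve a i₁ i₂ k t i * wcurve a i₁ i₂ k t i) = 0 := by
  rw [sum_univ_eq_add_add_sum_Jset i₁ i₂ h12, wcurve_i₁, wcurve_i₂ a i₁ i₂ k h12]
  have hJ : ∑ i ∈ Jset i₁ i₂, (a i : ℂ) * (wcurve a i₁ i₂ k t i * wcurve a i₁ i₂ k t i) =
      (Rfun a i₁ i₂ k t : ℂ) := by
    rw [Rfun, Complex.ofReal_sum]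
    refine Finset.sum_congr rfl fun i hi => ?_
    rw [wcurve_of_mem a i₁ i₂ k hi]
    push_cast
    ring
  rw [hJ]
  set R : ℂ := (Rfun a i₁ i₂ k t : ℂ)
  have h1 := mul_cst₁_sq a i₁ ha₁
  have h2 := mul_cst₂_sq a i₂ ha₂
  linear_combination (1 - R) ^ 2 * h1 + (1 + R) ^ 2 * h2

/-- **Positivity along the curve:** `∑ᵢ aᵢ |wᵢ(t)|² = (1 + R(t))² / 2`. [folklore] -/
theorem sum_mul_wcurve_conj (h12 : i₁ ≠ i₂) (ha₁ : 0 < a i₁) (ha₂ : 0 < a i₂) (t : ℝ) :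
    ∑ i, (a i : ℂ) * (wcurve a i₁ i₂ k t i * starRingEnd ℂ (wcurve a i₁ i₂ k t i)) =
      (((1 + Rfun a i₁ i₂ k t) ^ 2 / 2 : ℝ) : ℂ) := by
  rw [sum_univ_eq_add_add_sum_Jset i₁ i₂ h12, wcurve_i₁, wcurve_i₂ a i₁ i₂ k h12]
  have hJ : ∑ i ∈ Jset i₁ i₂, (a i : ℂ) * (wcurve a i₁ i₂ k t i *
      starRingEnd ℂ (wcurve a i₁ i₂ k t i)) = (Rfun a i₁ i₂ k t : ℂ) := by
    rw [Rfun, Complex.ofReal_sum]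
    refine Finset.sum_congr rfl fun i hi => ?_
    rw [wcurve_of_mem a i₁ i₂ k hi, Complex.conj_ofReal]
    push_cast
    ring
  rw [hJ]
  have h1 := mul_cst₁_conj a i₁ ha₁
  have h2 := mul_cst₂_conj a i₂ ha₂
  simp only [map_mul, map_sub, map_add, map_one, Complex.conj_ofReal]
  set R : ℂ := (Rfun a i₁ i₂ k t : ℂ)
  push_cast
  linear_combination (1 - R) ^ 2 * h1 + (1 + R) ^ 2 * h2

/-! ### Linear independence of the coordinate polynomials -/

/-- `R(X)` has no constant term. [folklore] -/
theorem RX_coeff_zero : (RX a i₁ i₂ k).coeff 0 = 0 := by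
  rw [RX, finsetSum_coeff]
  refine Finset.sum_eq_zero fun i _ => ?_
  rw [coeff_C_mul, coeff_X_pow, if_neg (two_mul_nexp_ne_zero k i).symm, mul_zero]

/-- `R(X)` has no monomial of odd degree `n_l`. [folklore] -/
theorem RX_coeff_nexp (l : ι) : (RX a i₁ i₂ k).coeff (nexp k l) = 0 := by
  rw [RX, finsetSum_coeff]
  refine Finset.sum_eq_zero fun i _ => ?_
  rw [coeff_C_mul, coeff_X_pow, if_neg (nexp_ne_two_mul k l i), mul_zero]

/-- The coefficient of `X^{2 n_j}` in `R(X)` is `a_j` (`j ∈ J`). [folklore] -/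
theorem RX_coeff_two_mul_nexp (hk : Function.Injective k) {j : ι} (hj : j ∈ Jset i₁ i₂) :
    (RX a i₁ i₂ k).coeff (2 * nexp k j) = a j := by
  rw [RX, finsetSum_coeff, Finset.sum_eq_single j]
  · rw [coeff_C_mul, coeff_X_pow, if_pos rfl, mul_one]
  · intro i _ hij
    rw [coeff_C_mul, coeff_X_pow, if_neg, mul_zero]
    intro h
    exact hij (nexp_injective k hk (by omega)).symm
  · intro h
    exact absurd hj h

/-- A linear combination of the `Wᵢ`, regrouped. [folklore] -/
theorem sum_smul_Wpoly (h12 : i₁ ≠ i₂) (g : ι → ℂ) :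
    ∑ i, g i • Wpoly a i₁ i₂ k i = C (g i₁ * cst₁ a i₁) * (1 - RX a i₁ i₂ k) +
      C (g i₂ * cst₂ a i₂) * (1 + RX a i₁ i₂ k) + ∑ i ∈ Jset i₁ i₂, C (g i) * X ^ nexp k i := by
  rw [sum_univ_eq_add_add_sum_Jset i₁ i₂ h12, Wpoly_i₁, Wpoly_i₂ a i₁ i₂ k h12, smul_eq_C_mul,
    smul_eq_C_mul, ← mul_assoc, ← mul_assoc, ← C_mul, ← C_mul]
  congr 1
  refine Finset.sum_congr rfl fun i hi => ?_
  rw [Wpoly_of_mem a i₁ i₂ k hi, smul_eq_C_mul]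

/-- **The coordinate polynomials `Wᵢ` are linearly independent over `ℂ`.** [folklore] -/
theorem linearIndependent_Wpoly (h12 : i₁ ≠ i₂) (ha₁ : 0 < a i₁) (ha₂ : 0 < a i₂)
    (hk : Function.Injective k) (hJ : ∀ i ∈ Jset i₁ i₂, a i ≠ 0) (hJne : (Jset i₁ i₂).Nonempty) :
    LinearIndependent ℂ (Wpoly a i₁ i₂ k) := by
  rw [Fintype.linearIndependent_iff]
  intro g hg
  rw [sum_smul_Wpoly a i₁ i₂ k h12] at hg
  -- the coefficient of `X^0`
  have e0 := congrArg (fun p => Polynomial.coeff p 0) hg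
  simp only [coeff_add, coeff_C_mul, coeff_sub, coeff_one_zero, RX_coeff_zero, finsetSum_coeff,
    coeff_X_pow, coeff_zero, sub_zero, add_zero, mul_one] at e0
  rw [Finset.sum_eq_zero (fun i _ => by rw [if_neg (nexp_pos k i).ne, mul_zero]), add_zero] at e0
  -- the coefficient of `X^{2 n_j}` for some `j ∈ J`
  obtain ⟨j, hj⟩ := hJne
  have ej := congrArg (fun p => Polynomial.coeff p (2 * nexp k j)) hg
  simp only [coeff_add, coeff_C_mul, coeff_sub, coeff_one, RX_coeff_two_mul_nexp a i₁ i₂ k hk hj,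
    finsetSum_coeff, coeff_X_pow, coeff_zero, if_neg (two_mul_nexp_ne_zero k j), zero_sub,
    zero_add] at ej
  rw [Finset.sum_eq_zero (fun i _ => by rw [if_neg (nexp_ne_two_mul k i j).symm, mul_zero]),
    add_zero] at ej
  have haj : (a j : ℂ) ≠ 0 := Complex.ofReal_ne_zero.2 (hJ j hj)
  have h2 : g i₂ * cst₂ a i₂ = 0 := by
    have : (g i₁ * cst₁ a i₁ + g i₂ * cst₂ a i₂) * a j + (g i₁ * cst₁ a i₁ * -(a j : ℂ) +
      g i₂ * cst₂ a i₂ * a j) = 2 * (g i₂ * cst₂ a i₂) * a j := by ring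
    rw [e0, ej, zero_mul, add_zero] at this
    have h := this.symm
    rw [mul_eq_zero, mul_eq_zero] at h
    rcases h with (h | h) | h
    · norm_num at h
    · exact h
    · exact absurd h haj
  have h1 : g i₁ * cst₁ a i₁ = 0 := by rwa [h2, add_zero] at e0
  have hg1 : g i₁ = 0 := (mul_eq_zero.1 h1).resolve_right (cst₁_ne_zero a i₁ ha₁)
  have hg2 : g i₂ = 0 := (mul_eq_zero.1 h2).resolve_right (cst₂_ne_zero a i₂ ha₂)
  -- the coefficient of `X^{n_l}` for `l ∈ J`
  intro l
  by_cases hl1 : l = i₁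
  · exact hl1 ▸ hg1
  by_cases hl2 : l = i₂
  · exact hl2 ▸ hg2
  have hl : l ∈ Jset i₁ i₂ := (mem_Jset i₁ i₂).2 ⟨hl1, hl2⟩
  have el := congrArg (fun p => Polynomial.coeff p (nexp k l)) hg
  simp only [coeff_add, coeff_C_mul, coeff_sub, coeff_one, RX_coeff_nexp, finsetSum_coeff,
    coeff_X_pow, coeff_zero, if_neg (nexp_pos k l).ne', sub_zero, add_zero, mul_zero,
    zero_add] at el
  rw [Finset.sum_eq_single l (fun i _ hil => by
      rw [if_neg (fun h => hil (nexp_injective k hk h).symm), mul_zero])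
    (fun h => absurd hl h), if_pos rfl, mul_one] at el
  exact el

/-! ### Finiteness of zero sets along the curve -/

/-- A non-zero complex polynomial has finitely many real zeros. [folklore] -/
theorem finite_setOf_eval_ofReal_eq_zero {p : ℂ[X]} (hp : p ≠ 0) :
    {t : ℝ | p.eval (t : ℂ) = 0}.Finite :=
  (Polynomial.finite_setOf_isRoot hp).preimage Complex.ofReal_injective.injOn

/-- A non-trivial linear combination of the coordinates of the curve vanishes at only finitely
many real `t`.
[folklore] -/
theorem finite_setOf_sum_mul_wcurve_eq_zero (hli : LinearIndependent ℂ (Wpoly a i₁ i₂ k))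
    {g : ι → ℂ} (hg : g ≠ 0) : {t : ℝ | ∑ i, g i * wcurve a i₁ i₂ k t i = 0}.Finite := by
  have hp : ∑ i, g i • Wpoly a i₁ i₂ k i ≠ 0 := fun h =>
    hg (funext (Fintype.linearIndependent_iff.1 hli g h))
  refine (finite_setOf_eval_ofReal_eq_zero hp).subset fun t ht => ?_
  rw [Set.mem_setOf_eq] at ht ⊢
  rw [eval_finsetSum, ← ht]
  refine Finset.sum_congr rfl fun i _ => ?_
  rw [smul_eq_C_mul, eval_mul, eval_C, wcurve]

/-- `R(t) = -1` for only finitely many real `t`. [folklore] -/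
theorem finite_setOf_Rfun_eq_neg_one : {t : ℝ | Rfun a i₁ i₂ k t = -1}.Finite := by
  have hp : RX a i₁ i₂ k + 1 ≠ 0 := by
    intro h
    have := congrArg (fun p => Polynomial.coeff p 0) h
    simp only [coeff_add, RX_coeff_zero, coeff_one_zero, coeff_zero, zero_add] at this
    exact one_ne_zero this
  refine (finite_setOf_eval_ofReal_eq_zero hp).subset fun t ht => ?_
  simp only [Set.mem_setOf_eq] at ht ⊢
  rw [eval_add, eval_one, RX_eval, ht]
  push_cast
  ring

/-- The curve never passes through the origin: its `i₁`- and `i₂`-coordinates cannot both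
vanish.
[folklore] -/
theorem wcurve_ne_zero (h12 : i₁ ≠ i₂) (ha₁ : 0 < a i₁) (ha₂ : 0 < a i₂) (t : ℝ) :
    wcurve a i₁ i₂ k t ≠ 0 := by
  intro h
  have h1 := congrFun h i₁
  have h2 := congrFun h i₂
  rw [wcurve_i₁, Pi.zero_apply, mul_eq_zero] at h1
  rw [wcurve_i₂ a i₁ i₂ k h12, Pi.zero_apply, mul_eq_zero] at h2
  rcases h1 with h1 | h1
  · exact cst₁_ne_zero a i₁ ha₁ h1
  rcases h2 with h2 | h2
  · exact cst₂_ne_zero a i₂ ha₂ h2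
  have e1 : (Rfun a i₁ i₂ k t : ℂ) = 1 := by linear_combination (-1 : ℂ) * h1
  have e2 : (Rfun a i₁ i₂ k t : ℂ) = -1 := by linear_combination h2
  rw [e1] at e2
  norm_num at e2

end Curve

end RealMult

/-! ### Assembly: the very general period vector and the proof of Thm. 7.1 -/

section Assembly

open Literature.NumberTheory.QuadraticForms RealMult

variable {E : Type u} [Field E] [NumberField E] {m : ℕ}

/-- The exponent injection `Fin m → ℕ` used for the curve. [folklore] -/
abbrev kFin (m : ℕ) : Fin m → ℕ := fun i => (i : ℕ)

/-- The period vector `ω(t) = ∑ᵢ wᵢ(t) x_i` in the `σ`-eigenspace `W_σ` of `ℂ ⊗ E^m`.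
[cite: BayerFluckigerVanGeemenSchuett2025, Thm. 7.1] -/
def periodVec (a : Fin m → ℝ) (i₁ i₂ : Fin m) (σ' : E →+* ℂ) (t : ℝ) : ℂ ⊗[ℚ] (Fin m → E) :=
  ∑ i, wcurve a i₁ i₂ (kFin m) t i • eigVec E (Fin m) σ' i

variable (a : Fin m → ℝ) (i₁ i₂ : Fin m) (σ' : E →+* ℂ)

open scoped Classical in
/-- The period vector has coordinates `wᵢ(t)` at `(i, σ)` and `0` elsewhere: it lies in the
eigenspace `W_σ`. [cite: BayerFluckigerVanGeemenSchuett2025, Thm. 7.1] -/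
theorem coords_periodVec (t : ℝ) (i : Fin m) (τ : E →+* ℂ) :
    coords E (Fin m) (periodVec a i₁ i₂ σ' t) i τ =
      if τ = σ' then wcurve a i₁ i₂ (kFin m) t i else 0 := by
  rw [periodVec, map_sum, Finset.sum_apply, Finset.sum_apply]
  simp only [map_smul, Pi.smul_apply, smul_eq_mul, coords_eigVec_apply]
  rw [Finset.sum_eq_single i (fun j _ hji => by rw [if_neg (Ne.symm hji), mul_zero])
    (fun h => absurd (Finset.mem_univ i) h), if_pos rfl, mul_ite, mul_one, mul_zero]

/-- The transfer form against the period vector only sees the `σ`-coordinates.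
[cite: BayerFluckigerVanGeemenSchuett2025, Thm. 7.1] -/
theorem trForm_baseChange_periodVec (α : Fin m → E) (t : ℝ) (y : ℂ ⊗[ℚ] (Fin m → E)) :
    (trForm E α).baseChange ℂ (periodVec a i₁ i₂ σ' t) y =
      ∑ i, σ' (α i) * (wcurve a i₁ i₂ (kFin m) t i * coords E (Fin m) y i σ') := by
  rw [trForm_baseChange_eq]
  refine Finset.sum_congr rfl fun i _ => ?_
  rw [Finset.sum_eq_single σ']
  · rw [coords_periodVec, if_pos rfl]
  · intro τ _ hτ
    rw [coords_periodVec, if_neg hτ, zero_mul, mul_zero]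
  · intro h
    exact absurd (Finset.mem_univ _) h

/-- `E` acts on the period vector through `σ`. [cite: BayerFluckigerVanGeemenSchuett2025, Thm. 7.1]
-/
theorem lsmul_baseChange_periodVec (e : E) (t : ℝ) :
    (Algebra.lsmul ℚ ℚ (Fin m → E) e).baseChange ℂ (periodVec a i₁ i₂ σ' t) =
      σ' e • periodVec a i₁ i₂ σ' t := by
  rw [periodVec, map_sum, Finset.smul_sum]
  refine Finset.sum_congr rfl fun i _ => ?_
  rw [map_smul, lsmul_baseChange_eigVec, smul_comm]

/-- The period vector is non-zero. [cite: BayerFluckigerVanGeemenSchuett2025, Thm. 7.1] -/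
theorem periodVec_ne_zero (h12 : i₁ ≠ i₂) (ha₁ : 0 < a i₁) (ha₂ : 0 < a i₂) (t : ℝ) :
    periodVec a i₁ i₂ σ' t ≠ 0 := by
  intro h
  apply wcurve_ne_zero a i₁ i₂ (kFin m) h12 ha₁ ha₂ t
  funext i
  have := congrArg (fun x => coords E (Fin m) x i σ') h
  simp only [coords_periodVec, if_true, map_zero, Pi.zero_apply] at this
  exact this

/-- `(f_ℂ - c) ω(t) = ∑ᵢ wᵢ(t) (f_ℂ - c) xᵢ`. [folklore] -/
theorem baseChange_periodVec_sub_smul (f : Module.End ℚ (Fin m → E)) (c : ℂ) (t : ℝ) :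
    f.baseChange ℂ (periodVec a i₁ i₂ σ' t) - c • periodVec a i₁ i₂ σ' t =
      ∑ i, wcurve a i₁ i₂ (kFin m) t i •
        (f.baseChange ℂ (eigVec E (Fin m) σ' i) - c • eigVec E (Fin m) σ' i) := by
  simp only [periodVec, map_sum, map_smul, Finset.smul_sum, smul_sub, Finset.sum_sub_distrib,
    smul_comm c]

/-- For `f ∉ E`, the period vector `ω(t)` is an eigenvector of `f_ℂ` with eigenvalue `c` for only
finitely many `t`.
[cite: BayerFluckigerVanGeemenSchuett2025, Thm. 7.1] -/
theorem finite_setOf_baseChange_periodVec_eq_smul [Nonempty (Fin m)]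
    (hli : LinearIndependent ℂ (Wpoly a i₁ i₂ (kFin m))) (f : Module.End ℚ (Fin m → E))
    (hf : f ∉ (Algebra.lsmul ℚ ℚ (Fin m → E) : E →ₐ[ℚ] Module.End ℚ (Fin m → E)).range)
    (c : ℂ) :
    {t : ℝ | f.baseChange ℂ (periodVec a i₁ i₂ σ' t) = c • periodVec a i₁ i₂ σ' t}.Finite := by
  have hex : ∃ i, f.baseChange ℂ (eigVec E (Fin m) σ' i) - c • eigVec E (Fin m) σ' i ≠ 0 := by
    by_contra h
    push Not at h
    obtain ⟨e, he⟩ := exists_eq_lsmul_of_baseChange_eigVec E σ' f c fun j => sub_eq_zero.1 (h j)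
    exact hf ⟨e, he.symm⟩
  obtain ⟨i₀, hi₀⟩ := hex
  obtain ⟨θ, hθ⟩ := Module.Projective.exists_dual_ne_zero ℂ hi₀
  set g : Fin m → ℂ := fun i =>
    θ (f.baseChange ℂ (eigVec E (Fin m) σ' i) - c • eigVec E (Fin m) σ' i) with hg_def
  have hg : g ≠ 0 := fun h => hθ (congrFun h i₀)
  refine (finite_setOf_sum_mul_wcurve_eq_zero a i₁ i₂ (kFin m) hli hg).subset fun t ht => ?_
  rw [Set.mem_setOf_eq] at ht ⊢
  have h := congrArg θ (sub_eq_zero.2 ht)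
  rw [baseChange_periodVec_sub_smul, map_sum, map_zero] at h
  rw [← h]
  refine Finset.sum_congr rfl fun i _ => ?_
  rw [map_smul, smul_eq_mul, mul_comm]

/-- `End_ℚ(E^m)` is countable. [folklore] -/
theorem countable_moduleEnd : Countable (Module.End ℚ (Fin m → E)) := by
  let b := Module.finBasis ℚ (Fin m → E)
  have hinj : Function.Injective fun (f : Module.End ℚ (Fin m → E)) (i j : Fin _) =>
      LinearMap.toMatrix b b f i j :=
    fun f g h =>
      (LinearMap.toMatrix b b).injective (Matrix.ext fun i j => congrFun (congrFun h i) j)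
  exact hinj.countable

/-- The `E`-action is self-adjoint for the trace form `Tr(∑ αᵢ xᵢ yᵢ)`.
[cite: BayerFluckigerVanGeemenSchuett2025, Thm. 7.1] -/
theorem trForm_lsmul (α : Fin m → E) (e : E) (x y : Fin m → E) :
    trForm E α (Algebra.lsmul ℚ ℚ (Fin m → E) e x) y =
      trForm E α x (Algebra.lsmul ℚ ℚ (Fin m → E) e y) := by
  simp only [Algebra.lsmul_coe, trForm_apply, Pi.smul_apply, smul_eq_mul]
  congr 1
  refine Finset.sum_congr rfl fun i _ => ?_
  ring

/-- **Bayer-Fluckiger–van Geemen–Schütt 2025, Thm. 7.1** (discharge of the named fact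
`BFvGS2025_exists_pseudoPolarization_endAlg_eq`).
[cite: BayerFluckigerVanGeemenSchuett2025, Thm. 7.1] -/
theorem BFvGS2025_exists_pseudoPolarization_endAlg_eq_holds :
    BFvGS2025_exists_pseudoPolarization_endAlg_eq.{u} := by
  intro E _ _ _ m hm α hα σ hσ hsig
  -- two indices at which `σ(αᵢ) > 0`
  obtain ⟨i₁, i₂, hi₁, hi₂, h12⟩ : ∃ i₁ i₂, i₁ ∈ Finset.univ.filter (fun i => 0 < σ (α i)) ∧
      i₂ ∈ Finset.univ.filter (fun i => 0 < σ (α i)) ∧ i₁ ≠ i₂ :=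
    Finset.one_lt_card_iff.1 (by rcases hσ with h | h <;> omega)
  simp only [Finset.mem_filter, Finset.mem_univ, true_and] at hi₁ hi₂
  set a : Fin m → ℝ := fun i => σ (α i) with ha_def
  set σ' : E →+* ℂ := Complex.ofRealHom.comp σ with hσ'_def
  have hσ'α : ∀ i, σ' (α i) = (a i : ℂ) := fun i => rfl
  have hJ : ∀ i ∈ Jset i₁ i₂, a i ≠ 0 := fun i _ => (map_ne_zero σ).2 (hα i)
  have hJne : (Jset i₁ i₂).Nonempty := by
    rw [← Finset.card_pos, Jset, Finset.card_sdiff_of_subset (Finset.subset_univ _),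
      Finset.card_univ, Fintype.card_fin, Finset.card_pair h12]
    omega
  have hk : Function.Injective (kFin m) := Fin.val_injective
  have hli := linearIndependent_Wpoly a i₁ i₂ (kFin m) h12 hi₁ hi₂ hk hJ hJne
  haveI : Nonempty (Fin m) := ⟨⟨0, by omega⟩⟩
  haveI : Countable (Module.End ℚ (Fin m → E)) := countable_moduleEnd
  -- the countable set of bad parameters
  set S : Set ℝ := {t | Rfun a i₁ i₂ (kFin m) t = -1} ∪
    ⋃ (f : Module.End ℚ (Fin m → E))
      (_ : f ∉ (Algebra.lsmul ℚ ℚ (Fin m → E) : E →ₐ[ℚ] Module.End ℚ (Fin m → E)).range),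
      ⋃ c ∈ {c : ℂ | Module.End.HasEigenvalue (f.baseChange ℂ) c},
        {t : ℝ | f.baseChange ℂ (periodVec a i₁ i₂ σ' t) = c • periodVec a i₁ i₂ σ' t} with hS_def
  have hS : S.Countable := by
    refine (finite_setOf_Rfun_eq_neg_one a i₁ i₂ (kFin m)).countable.union ?_
    refine Set.countable_iUnion fun f => Set.countable_iUnion fun hf => ?_
    refine (Module.End.finite_hasEigenvalue (f.baseChange ℂ)).countable.biUnion fun c _ => ?_
    exact (finite_setOf_baseChange_periodVec_eq_smul a i₁ i₂ σ' hli f hf c).countable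
  obtain ⟨t, ht⟩ : ∃ t, t ∉ S := by
    by_contra h
    push Not at h
    exact Cardinal.not_countable_real (hS.mono fun t _ => h t)
  have hR : Rfun a i₁ i₂ (kFin m) t ≠ -1 := fun h => ht (Or.inl h)
  have hgood : ∀ f : Module.End ℚ (Fin m → E),
      f ∉ (Algebra.lsmul ℚ ℚ (Fin m → E) : E →ₐ[ℚ] Module.End ℚ (Fin m → E)).range →
      ∀ c : ℂ, Module.End.HasEigenvalue (f.baseChange ℂ) c →
        f.baseChange ℂ (periodVec a i₁ i₂ σ' t) ≠ c • periodVec a i₁ i₂ σ' t :=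
    fun f hf c hc heq => ht (Or.inr (Set.mem_iUnion₂.2 ⟨f, hf, Set.mem_iUnion₂.2 ⟨c, hc, heq⟩⟩))
  -- the period vector
  set ω := periodVec a i₁ i₂ σ' t with hω_def
  rw [associated_transfer]
  have h0 : (trForm E α).baseChange ℂ ω ω = 0 := by
    rw [hω_def, trForm_baseChange_periodVec]
    simp only [coords_periodVec, if_true, hσ'α]
    exact sum_mul_wcurve_sq a i₁ i₂ (kFin m) h12 hi₁ hi₂ t
  have hr : 0 < (1 + Rfun a i₁ i₂ (kFin m) t) ^ 2 / 2 := by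
    have : 1 + Rfun a i₁ i₂ (kFin m) t ≠ 0 := fun h => hR (by linarith)
    positivity
  have h1eq : (trForm E α).baseChange ℂ ω (conj ω) =
      (((1 + Rfun a i₁ i₂ (kFin m) t) ^ 2 / 2 : ℝ) : ℂ) := by
    rw [hω_def, trForm_baseChange_periodVec]
    simp only [coords_conj, coords_periodVec, if_true, hσ'α]
    exact sum_mul_wcurve_conj a i₁ i₂ (kFin m) h12 hi₁ hi₂ t
  have h1 : (trForm E α).baseChange ℂ ω (conj ω) ≠ 0 := by
    rw [h1eq, Complex.ofReal_ne_zero]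
    exact hr.ne'
  refine ⟨ofPeriod (trForm E α) ω h0 h1, ?_, ?_, ?_⟩
  · -- pseudo-polarization
    refine isPseudoPolarization_ofPeriod h0 h1 (trForm_symm E α) ?_ ⟨_, hr, h1eq⟩
    have hfin : Module.finrank ℚ (Fin m → E) = Module.finrank ℚ E * m := by
      rw [Module.finrank_pi_fintype, Finset.sum_const, Finset.card_univ, Fintype.card_fin,
        smul_eq_mul, mul_comm]
    rw [toQuadraticMap_trForm, hfin]
    exact hsig
  · -- `E` acts on `V^{2,0}` through `σ`
    intro e x hx
    obtain ⟨c, rfl⟩ := (mem_piece_two_zero_ofPeriod h0 h1).1 hx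
    rw [map_smul, hω_def, lsmul_baseChange_periodVec, smul_comm]
    rfl
  · -- the Hodge endomorphism algebra is exactly `E`
    ext f
    constructor
    · intro hf
      by_contra hfr
      obtain ⟨c, hc⟩ := exists_smul_eq_of_mem_endAlg_ofPeriod h0 h1 hf
      have hev : Module.End.HasEigenvalue (f.baseChange ℂ) c :=
        Module.End.hasEigenvalue_of_hasEigenvector (Module.End.hasEigenvector_iff.2
          ⟨Module.End.mem_eigenspace_iff.2 hc, periodVec_ne_zero a i₁ i₂ σ' h12 hi₁ hi₂ t⟩)
      exact hgood f hfr c hev hc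
    · rintro ⟨e, rfl⟩
      exact mem_endAlg_ofPeriod h0 h1 (trForm_lsmul α e)
        (lsmul_baseChange_periodVec a i₁ i₂ σ' e t)

end Assembly


end HodgeStructure

end Literature.AlgebraicGeometry.Motives

end
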